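import Summits.HodgeConjecture.HodgeCM.Model.AdelicThetaDistributionMultSpanG_1

/-! PORT of `HodgeCM/Model/AdelicThetaDistributionMultSpanG.lean` (HodgeCMPerL run 82) — part 2: continuation of `Summits.HodgeConjecture.HodgeCM.Model.AdelicThetaDistributionMultSpanG_1` (split at a top-level declaration boundary by port_pkg.py; scope re-opened below; declarations unchanged). -/

-- port_pkg: scope re-opened for this part (file-level context, then the namespace/section stack open at the cut)
set_option autoImplicit false
noncomputable section
open NumberField hiding relNormOneIdeles relNormOneRat probHaarRelNormOneQuot
open _root_.NumberField.InfinitePlace _root_.NumberField.mixedEmbedding MeasureTheory MulAction IsDedekindDomain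
open scoped Matrix TensorProduct Classical SchwartzMap
open Literature.Geometry.ComplexHyperbolic.BallModel (U21 x₀ stabilizerEquivK21)
open Literature.NumberTheory.Automorphic.U21 (K21 matA sclD)
open Literature.NumberTheory.Automorphic Literature.NumberTheory.Automorphic.UnitaryGroup Literature.NumberTheory.Weil1964
open Literature.NumberTheory.GelbartRogawski1991 Literature.NumberTheory.GelbartRogawski1991.UnitaryDualPair
open Literature.AlgebraicGeometry.HodgeTheory Literature.AlgebraicGeometry.ShimuraVarieties Literature.AlgebraicGeometry.ShimuraVarieties.BallForms
open Literature.NumberTheory.Automorphic.PicardCM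
open Literature.NumberTheory.Transcendental (Arapura2012_Cor_15_4_6)
open Literature.Analysis.SegalBargmann
open HodgeCM.Adelic HodgeCM.PerL34 HodgeCM.Model.HypCensus HodgeCM.Model.ArchSideTerm HodgeCM.Model.ThetaDistFin HodgeCM.Model.TowerCarrier
open HodgeCM.Model.SupplyInstance HodgeCM.Model.SupplyResidual HodgeCM.Model.ThetaSpace
open HodgeCM.Model.SupplyResidual.WeilPairData (charInv)
namespace HodgeCM.Model
namespace ThetaAdelicSide
variable (hHD : exists_isReal_hodgeModel) (hI : hodgePQ_independent_of_hodgeModel)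
  (h₁ : BallQuotientUniformised) (h₃ : CMAbelianVarietyRealised) (hA : Arapura2012_Cor_15_4_6)
variable {L : CMField} {ι₁ : L →+* ℂ} (V : HermSpace3 L ι₁) (c : SeesawCtx L) (S : ThetaAdelicSide V c)
  (hGR : (cmSplittingDatum (L : Type) finProdFinEquiv (frameD V) (frameD_real V) (frameD_ne V) (dW c.D) (dW_real c.D)
    (dW_ne c.D)).CompatibleSplitting)
  (hGR₀ : (cmSplittingDatum (L : Type) (e₁) (frameD V) (frameD_real V) (frameD_ne V) (lineVec (L : Type) (dW c.D 0))
    (fun _ => dW_real c.D 0) (fun _ => dW_ne c.D 0)).CompatibleSplitting)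
  (hGR₁ : (cmSplittingDatum (L : Type) (e₁) (frameD V) (frameD_real V) (frameD_ne V) (lineVec (L : Type) (dW c.D 1))
    (fun _ => dW_real c.D 1) (fun _ => dW_ne c.D 1)).CompatibleSplitting)
  (hGR₂ : (cmSplittingDatum (L : Type) (e₁) (frameD V) (frameD_real V) (frameD_ne V) (lineVec (L : Type) (dW' c.D 0))
    (fun _ => dW'_real c.D 0) (fun _ => dW'_ne c.D 0)).CompatibleSplitting)
  (hGR₃ : (cmSplittingDatum (L : Type) (e₁) (frameD V) (frameD_real V) (frameD_ne V) (lineVec (L : Type) (dW' c.D 1))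
    (fun _ => dW'_real c.D 1) (fun _ => dW'_ne c.D 1)).CompatibleSplitting)
  (χ₀ χ₁ χ₂ χ₃ : CMAdelic (L : Type) (frameD V) × CMAdelicOne (L : Type) →* ℂˣ)
  (hι : S.ιinf = archInfOf V)
  (h₁W : (∀ j, 0 < (ι₁ (dW c.D j)).re) ∨ ∀ j, (ι₁ (dW c.D j)).re < 0)
  (hV : IsAnisotropic L V.Hm)
  (hemb : (InfinitePlace.mk ι₁).embedding = ι₁)
section Two
variable (hP : (S.P 2).ω = lineRepOf V c.D hGR hGR₀ hGR₁ hGR₂ hGR₃ χ₀ χ₁ χ₂ χ₃ 2)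
  (hχc : Continuous fun p => ((χ₂ p : ℂˣ) : ℂ))
  (eR : PosIdx (cmXW (L : Type) (frameD V) (lineVec (L : Type) (dW' c.D 0)) (fun _ => dW'_real c.D 0) ι₁ (HypCensus.cmPlace (L : Type) ι₁)) ≃ Unit)
  (eS : NegIdx (cmXW (L : Type) (frameD V) (lineVec (L : Type) (dW' c.D 0)) (fun _ => dW'_real c.D 0) ι₁ (HypCensus.cmPlace (L : Type) ι₁)) ≃ Empty)
  (hχ : ∀ u : stabilizer U21 x₀,
    ((lineScalar_two V c.D hGR hGR₂ hGR₃ χ₂ (u : U21) : ℂˣ) : ℂ) *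
        ((matA (stabilizerEquivK21.symm u)).det ^ (lineVacExponentsTwo V c hGR₂ eR eS).eP *
          sclD (stabilizerEquivK21.symm u) ^ (lineVacExponentsTwo V c hGR₂ eR eS).eQ) =
      star (sclD (stabilizerEquivK21.symm u)))
  (a : {v : InfinitePlace ↥(maximalRealSubfield L) // v.IsReal} → ℤ)
  (hω : ∀ b : {v : InfinitePlace ↥(maximalRealSubfield L) // v.IsReal}, b ≠ HypCensus.cmPlace (L : Type) ι₁ →
    ∀ (u : UnitaryGroup.archLocal (L : Type) 3 (Matrix.diagonal (frameD V)) (cmPlaceOver (L : Type) b)) (ℓ : Module.Dual ℂ (Fin 2 → ℂ)),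
      cmArchWeilRep (L : Type) e₁ (frameD V) (frameD_real V) (frameD_ne V) (lineVec (L : Type) (dW' c.D 0)) (fun _ => dW'_real c.D 0)
          (fun _ => dW'_ne c.D 0) hGR₂
          (UnitaryGroup.archSingle (↥(maximalRealSubfield L)) L (IsCMField.complexConj L) 3 (Matrix.diagonal (frameD V))
            (IsCMField.complexConj_ne_one L) (NumberField.complexConj_smul_infinitePlace (L : Type)) (cmPlaceOver (L : Type) b) u, 1)
          (blockFamilyOfAt (L : Type) e₁ (frameD V) (frameD_real V) (frameD_ne V) (lineVec (L : Type) (dW' c.D 0)) (fun _ => dW'_real c.D 0)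
            (fun _ => dW'_ne c.D 0) ι₁ (blockPosEquiv V) (blockNegEquiv V) eR eS (degOnePDual Empty) (binvPi 1) ℓ) =
        (((u : UnitaryGroup.archLocal (L : Type) 3 (Matrix.diagonal (frameD V)) (cmPlaceOver (L : Type) b)) : GL (Fin 3) ℂ) :
            Matrix (Fin 3) (Fin 3) ℂ).det ^ a b •
          blockFamilyOfAt (L : Type) e₁ (frameD V) (frameD_real V) (frameD_ne V) (lineVec (L : Type) (dW' c.D 0)) (fun _ => dW'_real c.D 0)
            (fun _ => dW'_ne c.D 0) ι₁ (blockPosEquiv V) (blockNegEquiv V) eR eS (degOnePDual Empty) (binvPi 1) ℓ)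
  (hdefI : ∀ b : {v : InfinitePlace ↥(maximalRealSubfield L) // v.IsReal}, b ≠ HypCensus.cmPlace (L : Type) ι₁ →
    ∀ u : UnitaryGroup.archLocal (L : Type) 3 (Matrix.diagonal (frameD V)) (cmPlaceOver (L : Type) b),
      ((archScalar_twoG V c.D hGR hGR₂ hGR₃ χ₂
          (UnitaryGroup.archSingle (↥(maximalRealSubfield L)) L (IsCMField.complexConj L) 3 (Matrix.diagonal (frameD V))
            (IsCMField.complexConj_ne_one L) (NumberField.complexConj_smul_infinitePlace (L : Type)) (cmPlaceOver (L : Type) b) u) : ℂˣ) : ℂ) *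
        (((u : UnitaryGroup.archLocal (L : Type) 3 (Matrix.diagonal (frameD V)) (cmPlaceOver (L : Type) b)) : GL (Fin 3) ℂ) :
            Matrix (Fin 3) (Fin 3) ℂ).det ^ a b = 1)

/-- **`hfam` clause 2 at the pin, slot 2, for saturated ADELIC THETA FORMS, pin-generically — NO archimedean hypothesis beyond the pin
identities**: for weight functions `𝓕 ⊆ {charInv χ}`, EVERY `F ∈ adelicThetaSpanSat (S.P 2) S.ιinf _ _ (satG hV K) 𝓕` lies in `holSatU` and has
its tower class in `⨆_{χ, charInv χ ∈ 𝓕} block(Ω_2(χ))`, `Ω_2(χ) = ((pinDatumTwoG …).coinvRep χ).asModule` (§ 1 at `hωA := rfl`; `hd`/`hCR` by carch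
`hd/hCR_lineOmega_twoG`, `Φarch ≠ 0` by `blockFamilyOfAt_degOnePDual_binvPi_one_ne_zero`). The landed `…holSat_pinTwoG` is the case `K := Γ.K`, `hF := hF.1`. -/
theorem clsU_mem_iSup_block_of_mem_adelicThetaSpanSat_pinTwoG
    {𝓕 : Set C(↥(relNormOneIdeles (↥(maximalRealSubfield L)) L) ⧸ relNormOneRat (↥(maximalRealSubfield L)) L, ℂ)}
    (h𝓕 : ∀ f ∈ 𝓕, ∃ χ : PontryaginDual (↥(relNormOneIdeles (↥(maximalRealSubfield L)) L) ⧸ relNormOneRat (↥(maximalRealSubfield L)) L),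
      f = charInv χ)
    (hGfin : ∀ K : Subgroup ↥V.adelicFin, ThetaDistDatum.satG hV K ≤ S.Gfin) (hLF : (S.P 2).IsLFAction) (K : Subgroup ↥V.adelicFin)
    {F : (V.latticeModel printFact_unitaryCompact_holds).G → (Fin 2 → ℂ)}
    (hF : F ∈ adelicThetaSpanSat (S.P 2) S.ιinf (stabilizer U21 x₀).subtype (BallForms.isPullbackCocycle_cotangentCocycle.weightOf x₀)
      (ThetaDistDatum.satG hV K) 𝓕) :
    ∃ hF' : F ∈ S.holSatU hV 2 𝓕,
      S.clsU hHD hI h₁ h₃ hA 𝓕 hι hV 2 ⟨F, hF'⟩ ∈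
        ⨆ (χ : PontryaginDual (↥(relNormOneIdeles (↥(maximalRealSubfield L)) L) ⧸ relNormOneRat (↥(maximalRealSubfield L)) L))
          (_ : charInv χ ∈ 𝓕),
          ⨆ ψ : ((pinDatumTwoG V c S hGR hGR₀ hGR₁ hGR₂ hGR₃ χ₀ χ₁ χ₂ χ₃ hι h₁W hV hemb hP hχc eR eS hχ a hω hdefI).coinvRep χ).asModule
              →ₗ[MonoidAlgebra ℂ ↥V.adelicFin] Tower hHD hI (ballQuotientUniformisedDatum_of h₁) h₃ hA V,
            (LinearMap.range ψ).restrictScalars ℂ :=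
  (pinDatumTwoG V c S hGR hGR₀ hGR₁ hGR₂ hGR₃ χ₀ χ₁ χ₂ χ₃ hι h₁W hV hemb hP hχc eR eS hχ a hω hdefI).clsU_mem_iSup_block_of_mem_adelicThetaSpanSat_of_lineRepOf_two
    hHD hI h₁ h₃ hA hGR hGR₀ hGR₁ hGR₂ hGR₃ χ₀ χ₁ χ₂ χ₃ hι h𝓕 hP rfl
    (fun h => ArchSideTerm.blockFamilyOfAt_degOnePDual_binvPi_one_ne_zero Empty (L : Type) e₁ (frameD V) (frameD_real V) (frameD_ne V)
      (lineVec (L : Type) (dW' c.D 0)) (fun _ => dW'_real c.D 0) (fun _ => dW'_ne c.D 0) ι₁ (blockPosEquiv V) (blockNegEquiv V) eR eS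
      (by change (pinDatumTwoG V c S hGR hGR₀ hGR₁ hGR₂ hGR₃ χ₀ χ₁ χ₂ χ₃ hι h₁W hV hemb hP hχc eR eS hχ a hω hdefI).Φarch _ = 0; rw [h]; rfl))
    hGfin hLF
    (hd_lineOmega_twoG V c hGR hGR₂ hGR₃ χ₂ (binvPi 1) eR eS hemb)
    (hCR_lineOmega_twoG V c hGR hGR₂ hGR₃ χ₂ (binvPi 1) eR eS hemb) K hF

end Two

/-! ### Slot 3 -/

section Three

variable (hP : (S.P 3).ω = lineRepOf V c.D hGR hGR₀ hGR₁ hGR₂ hGR₃ χ₀ χ₁ χ₂ χ₃ 3)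
  (hχc : Continuous fun p => ((χ₃ p : ℂˣ) : ℂ))
  (eR : PosIdx (cmXW (L : Type) (frameD V) (lineVec (L : Type) (dW' c.D 1)) (fun _ => dW'_real c.D 1) ι₁ (HypCensus.cmPlace (L : Type) ι₁)) ≃ Unit)
  (eS : NegIdx (cmXW (L : Type) (frameD V) (lineVec (L : Type) (dW' c.D 1)) (fun _ => dW'_real c.D 1) ι₁ (HypCensus.cmPlace (L : Type) ι₁)) ≃ Empty)
  (hχ : ∀ u : stabilizer U21 x₀,
    ((lineScalar_three V c.D hGR hGR₂ hGR₃ χ₃ (u : U21) : ℂˣ) : ℂ) *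
        ((matA (stabilizerEquivK21.symm u)).det ^ (lineVacExponentsThree V c hGR₃ eR eS).eP *
          sclD (stabilizerEquivK21.symm u) ^ (lineVacExponentsThree V c hGR₃ eR eS).eQ) =
      star (sclD (stabilizerEquivK21.symm u)))
  (a : {v : InfinitePlace ↥(maximalRealSubfield L) // v.IsReal} → ℤ)
  (hω : ∀ b : {v : InfinitePlace ↥(maximalRealSubfield L) // v.IsReal}, b ≠ HypCensus.cmPlace (L : Type) ι₁ →
    ∀ (u : UnitaryGroup.archLocal (L : Type) 3 (Matrix.diagonal (frameD V)) (cmPlaceOver (L : Type) b)) (ℓ : Module.Dual ℂ (Fin 2 → ℂ)),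
      cmArchWeilRep (L : Type) e₁ (frameD V) (frameD_real V) (frameD_ne V) (lineVec (L : Type) (dW' c.D 1)) (fun _ => dW'_real c.D 1)
          (fun _ => dW'_ne c.D 1) hGR₃
          (UnitaryGroup.archSingle (↥(maximalRealSubfield L)) L (IsCMField.complexConj L) 3 (Matrix.diagonal (frameD V))
            (IsCMField.complexConj_ne_one L) (NumberField.complexConj_smul_infinitePlace (L : Type)) (cmPlaceOver (L : Type) b) u, 1)
          (blockFamilyOfAt (L : Type) e₁ (frameD V) (frameD_real V) (frameD_ne V) (lineVec (L : Type) (dW' c.D 1)) (fun _ => dW'_real c.D 1)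
            (fun _ => dW'_ne c.D 1) ι₁ (blockPosEquiv V) (blockNegEquiv V) eR eS (degOnePDual Empty) (binvPi 1) ℓ) =
        (((u : UnitaryGroup.archLocal (L : Type) 3 (Matrix.diagonal (frameD V)) (cmPlaceOver (L : Type) b)) : GL (Fin 3) ℂ) :
            Matrix (Fin 3) (Fin 3) ℂ).det ^ a b •
          blockFamilyOfAt (L : Type) e₁ (frameD V) (frameD_real V) (frameD_ne V) (lineVec (L : Type) (dW' c.D 1)) (fun _ => dW'_real c.D 1)
            (fun _ => dW'_ne c.D 1) ι₁ (blockPosEquiv V) (blockNegEquiv V) eR eS (degOnePDual Empty) (binvPi 1) ℓ)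
  (hdefI : ∀ b : {v : InfinitePlace ↥(maximalRealSubfield L) // v.IsReal}, b ≠ HypCensus.cmPlace (L : Type) ι₁ →
    ∀ u : UnitaryGroup.archLocal (L : Type) 3 (Matrix.diagonal (frameD V)) (cmPlaceOver (L : Type) b),
      ((archScalar_threeG V c.D hGR hGR₂ hGR₃ χ₃
          (UnitaryGroup.archSingle (↥(maximalRealSubfield L)) L (IsCMField.complexConj L) 3 (Matrix.diagonal (frameD V))
            (IsCMField.complexConj_ne_one L) (NumberField.complexConj_smul_infinitePlace (L : Type)) (cmPlaceOver (L : Type) b) u) : ℂˣ) : ℂ) *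
        (((u : UnitaryGroup.archLocal (L : Type) 3 (Matrix.diagonal (frameD V)) (cmPlaceOver (L : Type) b)) : GL (Fin 3) ℂ) :
            Matrix (Fin 3) (Fin 3) ℂ).det ^ a b = 1)

/-- **`hfam` clause 2 at the pin, slot 3, for saturated ADELIC THETA FORMS, pin-generically — NO archimedean hypothesis beyond the pin
identities**: for weight functions `𝓕 ⊆ {charInv χ}`, EVERY `F ∈ adelicThetaSpanSat (S.P 3) S.ιinf _ _ (satG hV K) 𝓕` lies in `holSatU` and has
its tower class in `⨆_{χ, charInv χ ∈ 𝓕} block(Ω_3(χ))`, `Ω_3(χ) = ((pinDatumThreeG …).coinvRep χ).asModule` (§ 1 at `hωA := rfl`; `hd`/`hCR` by carch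
`hd/hCR_lineOmega_threeG`, `Φarch ≠ 0` by `blockFamilyOfAt_degOnePDual_binvPi_one_ne_zero`). The landed `…holSat_pinThreeG` is the case `K := Γ.K`, `hF := hF.1`. -/
theorem clsU_mem_iSup_block_of_mem_adelicThetaSpanSat_pinThreeG
    {𝓕 : Set C(↥(relNormOneIdeles (↥(maximalRealSubfield L)) L) ⧸ relNormOneRat (↥(maximalRealSubfield L)) L, ℂ)}
    (h𝓕 : ∀ f ∈ 𝓕, ∃ χ : PontryaginDual (↥(relNormOneIdeles (↥(maximalRealSubfield L)) L) ⧸ relNormOneRat (↥(maximalRealSubfield L)) L),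
      f = charInv χ)
    (hGfin : ∀ K : Subgroup ↥V.adelicFin, ThetaDistDatum.satG hV K ≤ S.Gfin) (hLF : (S.P 3).IsLFAction) (K : Subgroup ↥V.adelicFin)
    {F : (V.latticeModel printFact_unitaryCompact_holds).G → (Fin 2 → ℂ)}
    (hF : F ∈ adelicThetaSpanSat (S.P 3) S.ιinf (stabilizer U21 x₀).subtype (BallForms.isPullbackCocycle_cotangentCocycle.weightOf x₀)
      (ThetaDistDatum.satG hV K) 𝓕) :
    ∃ hF' : F ∈ S.holSatU hV 3 𝓕,
      S.clsU hHD hI h₁ h₃ hA 𝓕 hι hV 3 ⟨F, hF'⟩ ∈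
        ⨆ (χ : PontryaginDual (↥(relNormOneIdeles (↥(maximalRealSubfield L)) L) ⧸ relNormOneRat (↥(maximalRealSubfield L)) L))
          (_ : charInv χ ∈ 𝓕),
          ⨆ ψ : ((pinDatumThreeG V c S hGR hGR₀ hGR₁ hGR₂ hGR₃ χ₀ χ₁ χ₂ χ₃ hι hV hemb hP hχc eR eS hχ a hω hdefI).coinvRep χ).asModule
              →ₗ[MonoidAlgebra ℂ ↥V.adelicFin] Tower hHD hI (ballQuotientUniformisedDatum_of h₁) h₃ hA V,
            (LinearMap.range ψ).restrictScalars ℂ :=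
  (pinDatumThreeG V c S hGR hGR₀ hGR₁ hGR₂ hGR₃ χ₀ χ₁ χ₂ χ₃ hι hV hemb hP hχc eR eS hχ a hω hdefI).clsU_mem_iSup_block_of_mem_adelicThetaSpanSat_of_lineRepOf_three
    hHD hI h₁ h₃ hA hGR hGR₀ hGR₁ hGR₂ hGR₃ χ₀ χ₁ χ₂ χ₃ hι h𝓕 hP rfl
    (fun h => ArchSideTerm.blockFamilyOfAt_degOnePDual_binvPi_one_ne_zero Empty (L : Type) e₁ (frameD V) (frameD_real V) (frameD_ne V)
      (lineVec (L : Type) (dW' c.D 1)) (fun _ => dW'_real c.D 1) (fun _ => dW'_ne c.D 1) ι₁ (blockPosEquiv V) (blockNegEquiv V) eR eS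
      (by change (pinDatumThreeG V c S hGR hGR₀ hGR₁ hGR₂ hGR₃ χ₀ χ₁ χ₂ χ₃ hι hV hemb hP hχc eR eS hχ a hω hdefI).Φarch _ = 0; rw [h]; rfl))
    hGfin hLF
    (hd_lineOmega_threeG V c hGR hGR₂ hGR₃ χ₃ (binvPi 1) eR eS hemb)
    (hCR_lineOmega_threeG V c hGR hGR₂ hGR₃ χ₃ (binvPi 1) eR eS hemb) K hF

end Three

end ThetaAdelicSide
end HodgeCM.Model

-- port_pkg: scope closed for this part
end
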